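import Literature.NumberTheory.GaloisRepresentations.PstWeilDeligneHeredity
import HarnessLib

/-!
# De Rham-ness of a framed `ℚ̄_ℓ`-representation does not depend on the finite model

Topic `Literature/NumberTheory/GaloisRepresentations`; a theorems-only companion of `PstWeilDeligne.lean`
and `PstWeilDeligneHeredity.lean` (no definitions, no named facts).

Let `F` be a field, `ℓ` a prime, `alg` a `ℚ_ℓ`-algebra structure on `F` and `𝔅` a period-ring datum for
`Γ_F = Field.absoluteGaloisGroup F` over `ℚ_ℓ` with invariant field `F` (accepted `PeriodRingData`:
Fontaine's regular `(ℚ_ℓ, Γ_F)`-rings; intended `B_dR(F)`).  The accepted definition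
`FramedRep.IsDeRhamWith alg 𝔅 ρ` of "the framed `ρ : Γ_F →ₜ* GL_n(ℚ̄_ℓ)` is de Rham" asks for SOME
model `r₁` of `ρ` over SOME finite `E₁/ℚ_ℓ` inside `ℚ̄_ℓ` (accepted `HasQlModel`:
`ρ = P (r₁ ⊗_{E₁} ℚ̄_ℓ) P⁻¹`) whose underlying `ℚ_ℓ`-linear representation (accepted
`restrictScalarsQl` = `FramedRep.restrictScalars ℚ_ℓ`) is `𝔅`-admissible.  The main result of this
file is that then EVERY finite model is:

* `FramedRep.IsDeRhamWith.isAdmissible_of_hasQlModel` (and its `restrictScalarsQl`-spelling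
  `FramedRep.IsDeRhamWith.isDeRham_restrictScalarsQl`): if `ρ` is de Rham for `(alg, 𝔅)` and `rE`
  is any model of `ρ` over any finite `E/ℚ_ℓ`, then the `ℚ_ℓ`-restriction of `rE` is `𝔅`-admissible;
* `FramedRep.isDeRhamWith_iff_of_hasQlModel`: so, given one finite model `rE`, `ρ` is de Rham iff
  the `ℚ_ℓ`-restriction of `rE` is `𝔅`-admissible;
* `PstWeilDeligneData.IsDeRhamFramed.isDeRham_restrictScalarsQl`,
  `PstWeilDeligneData.isDeRhamFramed_iff_of_hasQlModel`: the same for a `p`-adic Hodge datum `𝔇`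
  of a non-archimedean local field (accepted `PstWeilDeligneData`, `IsDeRhamFramed`);
* `FramedGaloisRep.isDeRham_toLocal_restrictScalarsQl`: the local–global form used by the
  Fontaine–Mazur–Langlands statements — for a number field `K`, a GLOBAL finite model `rE` of
  `ρ : Γ_K →ₜ* GL_n(ℚ̄_ℓ)` and a place `v`, if `ρ|_{Γ_{K_v}}` is de Rham (for some local datum) then
  the restriction to `Γ_{K_v}` of the `ℚ_ℓ`-linear representation underlying `rE` is de Rham
  (`HasQlModel.toLocal`: a global model restricts to a local one; `GaloisRep.toLocal_restrictScalarsQl`).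

Proof of the main result.  By descent of the frame (`exists_conj_baseChange_eq_of_hasQlModel`) the
two models become, over finite extensions `E₁' ⊇ E₁` and `E₂' ⊇ E` inside `ℚ̄_ℓ`, framed
representations `s₁ = Q₁ (r₁ ⊗_{E₁} E₁') Q₁⁻¹` and `s₂ = Q₂ (rE ⊗_E E₂') Q₂⁻¹` with
`s₁ ⊗_{E₁'} ℚ̄_ℓ = ρ = s₂ ⊗_{E₂'} ℚ̄_ℓ`.  Over the compositum `E₃ = E₁' E₂'` (finite over `ℚ_ℓ`,
Mathlib `IntermediateField.finiteDimensional_sup`) the extensions of scalars of `s₁` and `s₂` still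
have extension of scalars `ρ` to `ℚ̄_ℓ` (`FramedRep.baseChange_baseChange`: base change is
functorial), hence they are EQUAL, since `E₃ → ℚ̄_ℓ` is injective (`FramedRep.baseChange_injective`).
Admissibility of the `ℚ_ℓ`-restriction is invariant under a finite extension of the coefficient
field (`PeriodRingData.isAdmissible_restrictScalars_baseChange_iff`: `E''ⁿ ≅ (E'ⁿ)^{[E'':E']}` as
`ℚ_ℓ[Γ_F]`-modules and finite direct sums are admissible iff all summands are — Fontaine, Exposé III,
Prop. 1.5.2) and under a change of frame (`PeriodRingData.isAdmissible_restrictScalars_conj_iff`), so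
it passes from `r₁` up to `E₃` and down to `rE`.  (Classically one would invoke instead "conjugate
over `ℚ̄_ℓ` ⇒ isomorphic over a finite extension"; the descent of the conjugating matrix makes this
unnecessary.)

## References

* J.-M. Fontaine, *Représentations `p`-adiques semi-stables*, Astérisque 223 (1994), Exposé III,
  Prop. 1.5.2 and Thm. 1.5.2 (sub-objects, quotients, direct sums of `B`-admissible representations;
  `B`-admissibility is a property of the `ℚ_p[Γ]`-isomorphism class). [FontaineAsterisque223III]
* K. Buzzard, T. Gee, *The conjectural connections between automorphic representations and Galois
  representations*, LMS Lecture Note Ser. 414 (2014), §2.2 (independence of the coefficient field).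
  [BuzzardGeeLMS2014]
-/

noncomputable section

open Field
open scoped NumberField

namespace Literature.NumberTheory.GaloisRepresentations

/-! ### Functoriality and injectivity of the extension of scalars of framed representations -/

section BaseChange

universe u

variable {G : Type u} [Group G] [TopologicalSpace G] {n : ℕ}

/-- **Extension of scalars of framed representations is functorial**:
`(ρ ⊗_f B) ⊗_g C = ρ ⊗_{g ∘ f} C` (entrywise, `g (f (ρ(x)_{ij}))`). [folklore] -/
theorem FramedRep.baseChange_baseChange {A B C : Type*} [CommRing A] [TopologicalSpace A]
    [CommRing B] [TopologicalSpace B] [CommRing C] [TopologicalSpace C] (f : A →+* B)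
    (hf : Continuous f) (g : B →+* C) (hg : Continuous g) (ρ : FramedRep G A n) :
    (ρ.baseChange f hf).baseChange g hg = ρ.baseChange (g.comp f) (hg.comp hf) :=
  ContinuousMonoidHom.ext fun _ => Units.ext <| Matrix.ext fun _ _ => rfl

/-- **Extension of scalars along an injective map is injective** on framed representations: two
framed representations over `A` with the same extension of scalars to `B ⊇ A` are equal (compare
entries). [folklore] -/
theorem FramedRep.baseChange_injective {A B : Type*} [CommRing A] [TopologicalSpace A]
    [CommRing B] [TopologicalSpace B] (f : A →+* B) (hf : Continuous f)
    (hinj : Function.Injective f) :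
    Function.Injective (FramedRep.baseChange (G := G) (n := n) f hf) := fun ρ ρ' h =>
  ContinuousMonoidHom.ext fun x => Units.ext <| Matrix.map_injective hinj <| by
    change ((ρ x : GL (Fin n) A) : Matrix (Fin n) (Fin n) A).map f =
      ((ρ' x : GL (Fin n) A) : Matrix (Fin n) (Fin n) A).map f
    rw [← FramedRep.coe_baseChange_apply f hf ρ, ← FramedRep.coe_baseChange_apply f hf ρ', h]

variable {ℓ : ℕ} [Fact ℓ.Prime]

/-- For intermediate fields `E' ≤ E''` of `ℚ̄_ℓ/ℚ_ℓ` and a framed representation `r` over `E'`: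
`(r ⊗_{E'} E'') ⊗_{E''} ℚ̄_ℓ = r ⊗_{E'} ℚ̄_ℓ` (the composite inclusion `E' → E'' → ℚ̄_ℓ` is the
inclusion `E' → ℚ̄_ℓ`, `algebraMap_comp_inclusion`). [folklore] -/
theorem FramedRep.baseChange_inclusion_baseChange_algebraMap
    {E' E'' : IntermediateField ℚ_[ℓ] (PadicAlgCl ℓ)} (h : E' ≤ E'') (r : FramedRep G E' n) :
    (r.baseChange (IntermediateField.inclusion h).toRingHom
        (continuous_intermediateField_inclusion h)).baseChange (algebraMap E'' (PadicAlgCl ℓ))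
          continuous_subtype_val =
      r.baseChange (algebraMap E' (PadicAlgCl ℓ)) continuous_subtype_val :=
  ContinuousMonoidHom.ext fun _ => Units.ext <| Matrix.ext fun _ _ => rfl

end BaseChange

/-! ### Model independence of de Rham-ness -/

section DeRham

variable {F : Type} [Field F] {ℓ : ℕ} [Fact ℓ.Prime]

-- Mathlib's own global value (nested instance problems on `𝔅.B ⊗[P] M`, see `PAdicHodgeProofs`).
set_option maxSynthPendingDepth 3 in
/-- **De Rham-ness does not depend on the finite model** (admissibility spelling).  Let `alg` be a
`ℚ_ℓ`-algebra structure on the field `F`, `𝔅` a period-ring datum for `Γ_F` over `ℚ_ℓ` with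
invariant field `F` (a regular `(ℚ_ℓ, Γ_F)`-ring; intended `B_dR(F)`), and
`ρ : Γ_F →ₜ* GL_n(ℚ̄_ℓ)` de Rham for `(alg, 𝔅)` (accepted `FramedRep.IsDeRhamWith`: SOME finite
model of `ρ` has `𝔅`-admissible `ℚ_ℓ`-restriction).  Then for EVERY finite extension `E/ℚ_ℓ`
inside `ℚ̄_ℓ` and every model `rE : Γ_F →ₜ* GL_n(E)` of `ρ` (`HasQlModel ρ E rE`:
`ρ = P (rE ⊗_E ℚ̄_ℓ) P⁻¹`), the `ℚ_ℓ`-linear representation underlying `rE` is `𝔅`-admissible.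
Proof: descend both frames to finite `E₁' ⊇ E₁`, `E₂' ⊇ E` (`exists_conj_baseChange_eq_of_hasQlModel`),
pass to the compositum `E₃ = E₁' E₂'`, where the two descended framed representations coincide
(functoriality and injectivity of `− ⊗ ℚ̄_ℓ`), and transport admissibility along finite extensions
of the coefficients (`isAdmissible_restrictScalars_baseChange_iff`, Fontaine's Prop. 1.5.2 for the
direct sum `E''ⁿ ≅ (E'ⁿ)^{[E'':E']}`) and changes of frame (`isAdmissible_restrictScalars_conj_iff`).
Ref: Fontaine, Astérisque 223 (1994), Exposé III, Prop. 1.5.2; Buzzard–Gee 2014, §2.2.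
[cite: FontaineAsterisque223III, Prop. 1.5.2] -/
theorem FramedRep.IsDeRhamWith.isAdmissible_of_hasQlModel (alg : Algebra ℚ_[ℓ] F)
    (𝔅 : PeriodRingData.{0, 0, 0, 0} (absoluteGaloisGroup F) ℚ_[ℓ] F) {n : ℕ}
    {ρ : FramedRep (absoluteGaloisGroup F) (PadicAlgCl ℓ) n} (h : ρ.IsDeRhamWith alg 𝔅)
    {E : IntermediateField ℚ_[ℓ] (PadicAlgCl ℓ)} [FiniteDimensional ℚ_[ℓ] E]
    {rE : FramedRep (absoluteGaloisGroup F) E n}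
    (hmodel : Literature.NumberTheory.Automorphic.HasQlModel ρ E rE) :
    𝔅.IsAdmissible (FramedRep.restrictScalars ℚ_[ℓ] rE) := by
  obtain ⟨E₁, hE₁, r₁, hmodel₁, hadm₁⟩ := h
  haveI := hE₁
  -- descent of the two frames to finite extensions `E₁' ⊇ E₁`, `E₂' ⊇ E`
  obtain ⟨E₁', h₁, hfin₁, Q₁, hT₁⟩ := exists_conj_baseChange_eq_of_hasQlModel hmodel₁
  obtain ⟨E₂', h₂, hfin₂, Q₂, hT₂⟩ := exists_conj_baseChange_eq_of_hasQlModel hmodel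
  haveI := hfin₁
  haveI := hfin₂
  have h₁₃ : E₁' ≤ E₁' ⊔ E₂' := le_sup_left
  have h₂₃ : E₂' ≤ E₁' ⊔ E₂' := le_sup_right
  -- over the compositum `E₃ = E₁' ⊔ E₂'` the two descended models coincide
  have heq :
      (FramedRep.conj Q₁ (r₁.baseChange (IntermediateField.inclusion h₁).toRingHom
          (continuous_intermediateField_inclusion h₁))).baseChange
        (IntermediateField.inclusion h₁₃).toRingHom (continuous_intermediateField_inclusion h₁₃) =
      (FramedRep.conj Q₂ (rE.baseChange (IntermediateField.inclusion h₂).toRingHom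
          (continuous_intermediateField_inclusion h₂))).baseChange
        (IntermediateField.inclusion h₂₃).toRingHom (continuous_intermediateField_inclusion h₂₃) :=
    FramedRep.baseChange_injective (algebraMap (E₁' ⊔ E₂' : IntermediateField ℚ_[ℓ] (PadicAlgCl ℓ))
        (PadicAlgCl ℓ)) continuous_subtype_val
      (algebraMap (E₁' ⊔ E₂' : IntermediateField ℚ_[ℓ] (PadicAlgCl ℓ)) (PadicAlgCl ℓ)).injective <| by
      rw [FramedRep.baseChange_inclusion_baseChange_algebraMap,
        FramedRep.baseChange_inclusion_baseChange_algebraMap, hT₁, hT₂]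
  -- transport admissibility from `r₁` up to `E₃` and down to `rE`
  have hadm₁' : 𝔅.IsAdmissible (FramedRep.restrictScalars ℚ_[ℓ] r₁) := hadm₁
  have hup := (𝔅.isAdmissible_restrictScalars_baseChange_iff h₁₃ _).2
    ((𝔅.isAdmissible_restrictScalars_conj_iff Q₁ _).2
      ((𝔅.isAdmissible_restrictScalars_baseChange_iff h₁ r₁).2 hadm₁'))
  rw [heq] at hup
  exact (𝔅.isAdmissible_restrictScalars_baseChange_iff h₂ rE).1
    ((𝔅.isAdmissible_restrictScalars_conj_iff Q₂ _).1
      ((𝔅.isAdmissible_restrictScalars_baseChange_iff h₂₃ _).1 hup))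

/-- **De Rham-ness does not depend on the finite model** (`restrictScalarsQl` / `IsDeRham` spelling,
definitionally the previous statement): if `ρ : Γ_F →ₜ* GL_n(ℚ̄_ℓ)` is de Rham for `(alg, 𝔅)` then
for every finite model `rE` of `ρ` over `E ⊆ ℚ̄_ℓ` the `ℚ_ℓ`-linear Galois representation underlying
`rE` (accepted `restrictScalarsQl`) is de Rham for `𝔅` (accepted `GaloisRep.IsDeRham`).
Ref: Fontaine, Astérisque 223 (1994), Exposé III, Prop. 1.5.2; Buzzard–Gee 2014, §2.2.
[cite: FontaineAsterisque223III, Prop. 1.5.2] -/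
theorem FramedRep.IsDeRhamWith.isDeRham_restrictScalarsQl (alg : Algebra ℚ_[ℓ] F)
    (𝔅 : PeriodRingData.{0, 0, 0, 0} (absoluteGaloisGroup F) ℚ_[ℓ] F) {n : ℕ}
    {ρ : FramedRep (absoluteGaloisGroup F) (PadicAlgCl ℓ) n} (h : ρ.IsDeRhamWith alg 𝔅)
    {E : IntermediateField ℚ_[ℓ] (PadicAlgCl ℓ)} [FiniteDimensional ℚ_[ℓ] E]
    {rE : FramedRep (absoluteGaloisGroup F) E n}
    (hmodel : Literature.NumberTheory.Automorphic.HasQlModel ρ E rE) :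
    letI := alg; (Literature.NumberTheory.Automorphic.restrictScalarsQl E rE).IsDeRham 𝔅 :=
  h.isAdmissible_of_hasQlModel alg 𝔅 hmodel

/-- **Given one finite model, de Rham-ness is admissibility of that model**: for a model `rE` of
`ρ : Γ_F →ₜ* GL_n(ℚ̄_ℓ)` over a finite `E/ℚ_ℓ`, `ρ` is de Rham for `(alg, 𝔅)` iff the
`ℚ_ℓ`-restriction of `rE` is `𝔅`-admissible (`→`: model independence; `←`: the definition).
Ref: Fontaine, Astérisque 223 (1994), Exposé III, Prop. 1.5.2; Buzzard–Gee 2014, §2.2.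
[cite: FontaineAsterisque223III, Prop. 1.5.2] -/
theorem FramedRep.isDeRhamWith_iff_of_hasQlModel (alg : Algebra ℚ_[ℓ] F)
    (𝔅 : PeriodRingData.{0, 0, 0, 0} (absoluteGaloisGroup F) ℚ_[ℓ] F) {n : ℕ}
    {ρ : FramedRep (absoluteGaloisGroup F) (PadicAlgCl ℓ) n}
    {E : IntermediateField ℚ_[ℓ] (PadicAlgCl ℓ)} [FiniteDimensional ℚ_[ℓ] E]
    {rE : FramedRep (absoluteGaloisGroup F) E n}
    (hmodel : Literature.NumberTheory.Automorphic.HasQlModel ρ E rE) :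
    ρ.IsDeRhamWith alg 𝔅 ↔ 𝔅.IsAdmissible (FramedRep.restrictScalars ℚ_[ℓ] rE) :=
  ⟨fun h => h.isAdmissible_of_hasQlModel alg 𝔅 hmodel, fun h => ⟨E, ‹_›, rE, hmodel, h⟩⟩

/-- **De Rham-ness for a `p`-adic Hodge datum does not depend on the finite model**: for a
non-archimedean local field `F`, a datum `𝔇 : PstWeilDeligneData F ℓ` and `ρ : Γ_F →ₜ* GL_n(ℚ̄_ℓ)`
de Rham for `𝔇` (accepted `IsDeRhamFramed`), every finite model `rE` of `ρ` has de Rham underlying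
`ℚ_ℓ`-linear representation (for `(𝔇.algebra, 𝔇.𝔅)`).
Ref: Fontaine, Astérisque 223 (1994), Exposé III, Prop. 1.5.2; Buzzard–Gee 2014, §2.2.
[cite: FontaineAsterisque223III, Prop. 1.5.2] -/
theorem PstWeilDeligneData.IsDeRhamFramed.isDeRham_restrictScalarsQl [ValuativeRel F]
    [TopologicalSpace F] [IsNonarchimedeanLocalField F] {𝔇 : PstWeilDeligneData F ℓ} {n : ℕ}
    {ρ : FramedRep (absoluteGaloisGroup F) (PadicAlgCl ℓ) n} (h : 𝔇.IsDeRhamFramed ρ)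
    {E : IntermediateField ℚ_[ℓ] (PadicAlgCl ℓ)} [FiniteDimensional ℚ_[ℓ] E]
    {rE : FramedRep (absoluteGaloisGroup F) E n}
    (hmodel : Literature.NumberTheory.Automorphic.HasQlModel ρ E rE) :
    letI := 𝔇.algebra; (Literature.NumberTheory.Automorphic.restrictScalarsQl E rE).IsDeRham 𝔇.𝔅 :=
  FramedRep.IsDeRhamWith.isAdmissible_of_hasQlModel 𝔇.algebra 𝔇.𝔅 h hmodel

/-- For a `p`-adic Hodge datum `𝔇` and one finite model `rE` of `ρ : Γ_F →ₜ* GL_n(ℚ̄_ℓ)`: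
`ρ` is de Rham for `𝔇` iff the `ℚ_ℓ`-linear representation underlying `rE` is.
Ref: Fontaine, Astérisque 223 (1994), Exposé III, Prop. 1.5.2; Buzzard–Gee 2014, §2.2.
[cite: FontaineAsterisque223III, Prop. 1.5.2] -/
theorem PstWeilDeligneData.isDeRhamFramed_iff_of_hasQlModel [ValuativeRel F] [TopologicalSpace F]
    [IsNonarchimedeanLocalField F] (𝔇 : PstWeilDeligneData F ℓ) {n : ℕ}
    {ρ : FramedRep (absoluteGaloisGroup F) (PadicAlgCl ℓ) n}
    {E : IntermediateField ℚ_[ℓ] (PadicAlgCl ℓ)} [FiniteDimensional ℚ_[ℓ] E]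
    {rE : FramedRep (absoluteGaloisGroup F) E n}
    (hmodel : Literature.NumberTheory.Automorphic.HasQlModel ρ E rE) :
    𝔇.IsDeRhamFramed ρ ↔
      letI := 𝔇.algebra; (Literature.NumberTheory.Automorphic.restrictScalarsQl E rE).IsDeRham 𝔇.𝔅 :=
  FramedRep.isDeRhamWith_iff_of_hasQlModel 𝔇.algebra 𝔇.𝔅 hmodel

end DeRham

/-! ### Global models restrict to local models -/

section Global

open IsDedekindDomain

variable {K : Type} [Field K] [NumberField K] {ℓ : ℕ} [Fact ℓ.Prime] {n : ℕ}

/-- **A global model restricts to a local model**: if `ρ = P (rE ⊗_E ℚ̄_ℓ) P⁻¹` on `Γ_K` then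
`ρ|_{Γ_{K_v}} = P (rE|_{Γ_{K_v}} ⊗_E ℚ̄_ℓ) P⁻¹` (change of frame and of coefficients commute with
restriction to the decomposition group, definitionally).  Deliberate dot-notation extension of the
accepted `Literature.NumberTheory.Automorphic.HasQlModel`, declared with its absolute name. [folklore] -/
theorem _root_.Literature.NumberTheory.Automorphic.HasQlModel.toLocal
    {ρ : FramedGaloisRep K (PadicAlgCl ℓ) n} {E : IntermediateField ℚ_[ℓ] (PadicAlgCl ℓ)}
    {rE : FramedGaloisRep K E n} (h : Literature.NumberTheory.Automorphic.HasQlModel ρ E rE)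
    (v : HeightOneSpectrum (𝓞 K)) :
    Literature.NumberTheory.Automorphic.HasQlModel (ρ.toLocal v) E (rE.toLocal v) := by
  obtain ⟨P, rfl⟩ := h
  exact ⟨P, ContinuousMonoidHom.ext fun _ => rfl⟩

/-- Restriction to the decomposition group at `v` commutes with restriction of scalars to `ℚ_ℓ`:
`(rE|_{ℚ_ℓ})|_{Γ_{K_v}} = (rE|_{Γ_{K_v}})|_{ℚ_ℓ}` (same maps), definitionally. [folklore] -/
theorem GaloisRep.toLocal_restrictScalarsQl (E : IntermediateField ℚ_[ℓ] (PadicAlgCl ℓ))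
    (rE : FramedGaloisRep K E n) (v : HeightOneSpectrum (𝓞 K)) :
    (Literature.NumberTheory.Automorphic.restrictScalarsQl E rE).toLocal v =
      Literature.NumberTheory.Automorphic.restrictScalarsQl E (rE.toLocal v) :=
  rfl

-- Mathlib's own global value (nested instance problems on `𝔅.B ⊗[P] M`, see `PAdicHodgeProofs`).
set_option maxSynthPendingDepth 3 in
/-- **Model independence, local–global form.**  Let `K` be a number field,
`ρ : Γ_K →ₜ* GL_n(ℚ̄_ℓ)` with a GLOBAL finite model `rE` over `E ⊆ ℚ̄_ℓ` (`HasQlModel ρ E rE`), `v`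
a finite place, `alg` a `ℚ_ℓ`-structure on `K_v` and `𝔅` a period-ring datum for `Γ_{K_v}`
(intended: `v ∣ ℓ`, `B_dR(K_v)`).  If `ρ|_{Γ_{K_v}}` is de Rham for `(alg, 𝔅)` — i.e. SOME LOCAL
finite model of it has admissible `ℚ_ℓ`-restriction — then the restriction to `Γ_{K_v}` of the
`ℚ_ℓ`-linear representation underlying `rE` is de Rham: the de Rham clause at `v` of the accepted
`GaloisRep.IsGeometric` for `restrictScalarsQl E rE`, as consumed by lang.S03
`FontaineMazurLanglandsGLn`.  (`HasQlModel.toLocal` + `isAdmissible_of_hasQlModel` +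
`GaloisRep.toLocal_restrictScalarsQl`.)
Ref: Fontaine, Astérisque 223 (1994), Exposé III, Prop. 1.5.2; Fontaine–Mazur 1995, §1;
Buzzard–Gee 2014, §2.2. [cite: FontaineAsterisque223III, Prop. 1.5.2] -/
theorem FramedGaloisRep.isDeRham_toLocal_restrictScalarsQl
    {ρ : FramedGaloisRep K (PadicAlgCl ℓ) n} {E : IntermediateField ℚ_[ℓ] (PadicAlgCl ℓ)}
    [FiniteDimensional ℚ_[ℓ] E] {rE : FramedGaloisRep K E n}
    (hmodel : Literature.NumberTheory.Automorphic.HasQlModel ρ E rE) (v : HeightOneSpectrum (𝓞 K))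
    (alg : Algebra ℚ_[ℓ] (v.adicCompletion K))
    (𝔅 : PeriodRingData.{0, 0, 0, 0} (absoluteGaloisGroup (v.adicCompletion K)) ℚ_[ℓ]
      (v.adicCompletion K))
    (h : (ρ.toLocal v).IsDeRhamWith alg 𝔅) :
    ((Literature.NumberTheory.Automorphic.restrictScalarsQl E rE).toLocal v).IsDeRham 𝔅 := by
  rw [GaloisRep.toLocal_restrictScalarsQl]
  exact h.isDeRham_restrictScalarsQl alg 𝔅 (hmodel.toLocal v)

end Global

end Literature.NumberTheory.GaloisRepresentations

end
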